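import Summits.CriticalPhenomena.PercolationContinuityZ3.Theorems.PercNearOneGluingNoHeavyPcintKernNFZ3S8Check1
import Summits.CriticalPhenomena.PercolationContinuityZ3.Theorems.PercNearOneGluingNoHeavyPcintKernNFZ3S8Check2
import Summits.CriticalPhenomena.PercolationContinuityZ3.Theorems.PercNearOneGluingNoHeavyPcintKernNFZ3S8Check3
import Summits.CriticalPhenomena.PercolationContinuityZ3.Theorems.PercNearOneGluingNoHeavyPcintKernNFZ3S8Check4
import Summits.CriticalPhenomena.PercolationContinuityZ3.Theorems.PercNearOneGluingNoHeavyPcintKernNFZ3S8Check5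
import Summits.CriticalPhenomena.PercolationContinuityZ3.Theorems.PercNearOneGluingNoHeavyPcintKernNFZ3S8Check6
import Summits.CriticalPhenomena.PercolationContinuityZ3.Theorems.PercNearOneGluingNoHeavyPcintKernNFZ3S8Check7
import Summits.CriticalPhenomena.PercolationContinuityZ3.Theorems.PercNearOneGluingNoHeavyPcintKernNFZ3S8Check8
import Summits.CriticalPhenomena.PercolationContinuityZ3.Theorems.PercNearOneGluingNoHeavyPcintKernNFZ3S8Check9
import Summits.CriticalPhenomena.PercolationContinuityZ3.Theorems.PercNearOneGluingNoHeavyPcintKernNFZ3S8Check10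
import Summits.CriticalPhenomena.PercolationContinuityZ3.Theorems.PercNearOneGluingNoHeavyPcintKernNFZ3S8Check11
import Summits.CriticalPhenomena.PercolationContinuityZ3.Theorems.PercNearOneGluingNoHeavyPcintKernNFZ3S8Check12
import HarnessLib

/-!
# PCINT lane: `p_c^site(ℤ³) ≥ 0.2482` (kernel-checked B2r window certificate on normal forms, memory 8 (7-step windows; 6896 first-use normal forms of 279936 codes); printed lower bound = the bond one).

Cell `prim-pcint`, seat `prim-pcint-2` (gen 2); memo `run/shared/lean/prim/pcint/INTERVAL-PLAN.md` §15.  Does NOT build on p205010.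
Assembles the kernel-checked row blocks (`…KernNFZ3S8Check1..12`), closes the enumeration (`WinK.all_nfCodes_of_nfCodesIn`,
`WinK.allRange_nfOKS_of_nfCodes`) and applies `WinK.le_siteCriticalProb_of_checkSK` (`…PcintWinKernelSymCert`).
No external certificate, no `native_decide`; axioms standard.
-/

namespace Summit.CriticalPhenomena.PercolationContinuityZ3.Theorems.Pcint

open Literature.Probability.Percolation Literature.Probability.LatticeModels NFZ3S8

/-- All Collatz–Wielandt rows on the normal forms of the `279936` window codes check. [folklore] -/
theorem NFZ3S8.chkAll : (WinK.nfCodes 3 7).all (WinK.rowOKSK 3 6 2482 9446 99999 tbl 33818) = true :=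
  WinK.all_nfCodes_of_nfCodesIn (hi := 279936) (WinK.all_of_allB (fuel := 20) (by decide +kernel)) (WinK.all_nfCodesIn_append (WinK.all_nfCodesIn_append (WinK.all_nfCodesIn_append (WinK.all_nfCodesIn_append (WinK.all_nfCodesIn_append (WinK.all_nfCodesIn_append (WinK.all_nfCodesIn_append (WinK.all_nfCodesIn_append (WinK.all_nfCodesIn_append (WinK.all_nfCodesIn_append (WinK.all_nfCodesIn_append chkFile_1 chkFile_2) chkFile_3) chkFile_4) chkFile_5) chkFile_6) chkFile_7) chkFile_8) chkFile_9) chkFile_10) chkFile_11) chkFile_12)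

/-- **`p_c^site(ℤ³) ≥ 0.2482`** (kernel-checked B2r window certificate on normal forms, memory 8 (7-step windows; 6896 first-use normal forms of 279936 codes); printed lower bound = the bond one). [folklore] -/
theorem siteCriticalProb_Z3_ge_02482 : (0.2482 : ℝ) ≤ siteCriticalProb (zdGraph 3) 0 := by
  have h := WinK.le_siteCriticalProb_of_checkSK (d := 3) (m := 6) (pn := 2482) (Q := 9446) (lamN := 99999)
      (tbl := tbl) (dflt := 33818) (vlo := 33818) (vhi := 100000) (by norm_num) (by norm_num) (by norm_num) (by norm_num)
      (by norm_num) tbl_bounds (by norm_num) (by norm_num)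
      (WinK.allRange_nfOKS_of_nfCodes chkAll)
  have e : ((2482 : ℕ) : ℝ) / 10 ^ 4 = 0.2482 := by norm_num
  rw [e] at h
  exact h

end Summit.CriticalPhenomena.PercolationContinuityZ3.Theorems.Pcint
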